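import Summits.ABC.IUTFork.Conditional.HexHullThresholdGenuineRows
import HarnessLib

/-!
# Branch C / R-H × R-W «GENUINE-NEG» BANDS through R-H row 4's floor-exact hull threshold, UNIFORM in the prime `l` (part C):
# `k = 12` at EVERY prime `1681 ≤ l ≤ 3361` — aligning `k = 12` with abc-iut-W-neg-2's `k ≥ 13 @ l ≤ 3361`

PROOF-ONLY file (0 definitions, 0 `Prop` facts, no instance, no notation) of the abc-iut cell (seat abc-iut-rh-typ-4 gen 2; D-0079 rescue
sub-cells R-H / R-W, lane U; ROUND-2 Q3 input). TAKES NO SIDE on [IUTchIII] Cor. 3.12 (S. Mochizuki, *Inter-universal Teichmüller theory III*,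
RIMS manuscript, Cor. 3.12 p. 173–174, Step (xi-f) p. 184) or on any author.

INPUT (nothing restated): this seat's ENGINE `GenuineK.not_pilotKummerCompatHull_lamSeven_of_not_hullCell` (p473071 ✓) at the TOP label with the
local type `B = 15` (even `k`; abc-iut-w4-d087 `GenuineK.localType_lamSeven_fifteen`); §1 cell tables by `interval_cases l` in seven chunks of
240 values (default heartbeats; composites dismissed by `norm_num`, cells by `norm_num`; audit note abc-iut-w5-d167 23:42:34Z «the 1680 bound
is a chunking bound»); §2 **`HexHullThreshold.not_pilotKummerCompatHull_lamSeven_twelve_band_high`** (`l.Prime`, `1681 ≤ l ≤ 3361`): at EVERY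
genuine Θ-volume datum `T` over `(ratPoint λ_12, l)`, for EVERY choice of the free binders, `PilotKummerCompatHull` at the sharp genuine setting
with the CHOSEN realising ideles and the PINNED reading FAILS. With part B (`…_twelve_band`, `481–1680`), abc-iut-W-neg-2 (`12 @ 11–480`,
`k ≥ 13 @ 11–3361`): **every `k ≥ 12` at every prime `11 ≤ l ≤ 3361` (`l ∤ k`)** is decided on the refuted side; `k ∈ {8, 9, 10, 11}` have the
EXACT finite reaches `71 / 101 / 881 / 811` of parts A/B.
HONEST SCOPE: SHARP reading; the per-label licence is a STRONGER-THAN-PRINT sufficient form of (xi-f); a failing top-label diagonal packet says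
NOTHING about the printed GLOBAL inequality, the number-level `Cor22.Cor312AtDatum`, or any author's intended hull; HEX rows are Szpiro-GOOD
(window binder `hSHw` of the uncut records only); admissibility `CondP6` of `(λ_k, l)` is NOT asserted (the theorem holds at every datum `T`);
no side taken on any author; typed ≠ proved; refuted-as-typed ≠ refuted-in-print; no abc claim.
[cite: Mochizuki2012, IUTchIII Cor. 3.12 Step (xi-f) p. 184; IUTchIV Prop. 1.1 p. 9, Prop. 1.2 (i)(ii) p. 10] [cite: DupuyHilado2025, §3.4, §4.9, §4.12]
[claim: Mochizuki2012, status: disputed] for every IUT quotation.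
-/

noncomputable section

open Set Function NumberField IsDedekindDomain

namespace Summit.ABC.IUTFork.Conditional

open Thm311 Thm311.Real Cor312 Cor312Vol Cor312Prov Literature.IUT.LogThetaLattice Literature.IUT.LogVolume
  Literature.IUT.HodgeTheaters Literature.IUT.LogVolume.ThetaData
  Literature.NumberTheory.NumberFields Literature.NumberTheory.DiophantineGeometry.GenEll
  Literature.NumberTheory.DiophantineGeometry Summit.ABC.ABC.Theorems Literature.NumberTheory.GaloisRepresentations.Ultrametric
  Summit.ABC.IUTFork.Repair.RH.HullThresholdExact

/-! ## §1. Cell tables, `k = 12`, primes `1681 ≤ l ≤ 3361` (seven chunks) -/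

/-- **CELL TABLE, `k = 12`, EVERY prime `1681 ≤ l ≤ 1920` (`B = 15`)**: for every `d ∣ 15` the column `HullCell` FAILS at
`(l·d, 12·d, l⋇, ⌊l·d/6⌋+1, 7^{a₀} − a₀·l·d)`, `a₀` the turning point; `interval_cases l`, composites by `norm_num`, cells by `norm_num`. [folklore] -/
theorem HexHullThreshold.cells_twelve_high1 : ∀ l : ℕ, 1681 ≤ l → l ≤ 1920 → l.Prime →
    ∀ d : ℕ, d ∣ 15 → ∃ a₀ : ℕ, (∀ a, a < a₀ → (1 : ℤ) * (7 : ℤ) ^ a * ((7 : ℤ) - 1) < ((l * d : ℕ) : ℤ)) ∧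
      ((l * d : ℕ) : ℤ) ≤ 1 * (7 : ℤ) ^ a₀ * ((7 : ℤ) - 1) ∧
      ¬ HullCell ((l * d : ℕ) : ℤ) ((12 * d : ℕ) : ℤ) ((((l - 1) / 2 - 1 : ℕ) : ℤ) + 1) ((l * d / 6 + 1 : ℕ) : ℤ)
        ((7 : ℤ) ^ a₀ - (a₀ : ℤ) * ((l * d : ℕ) : ℤ)) := by
  intro l hlo hhi hl d hd
  interval_cases l
  all_goals
    first
    | (exfalso; norm_num at hl; done)
    | (rcases HexHullThreshold.eq_of_dvd_fifteen hd with rfl | rfl | rfl | rfl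
       all_goals
        first
        | (refine ⟨3, ?_, ?_, ?_⟩ <;>
            [(intro a ha; interval_cases a <;> (norm_num; done)); (norm_num; done); (norm_num [HullCell]; done)])
        | (refine ⟨4, ?_, ?_, ?_⟩ <;>
            [(intro a ha; interval_cases a <;> (norm_num; done)); (norm_num; done); (norm_num [HullCell]; done)])
        | (refine ⟨5, ?_, ?_, ?_⟩ <;>
            [(intro a ha; interval_cases a <;> (norm_num; done)); (norm_num; done); (norm_num [HullCell]; done)]))

/-- **CELL TABLE, `k = 12`, EVERY prime `1921 ≤ l ≤ 2160` (`B = 15`)**: for every `d ∣ 15` the column `HullCell` FAILS at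
`(l·d, 12·d, l⋇, ⌊l·d/6⌋+1, 7^{a₀} − a₀·l·d)`, `a₀` the turning point; `interval_cases l`, composites by `norm_num`, cells by `norm_num`. [folklore] -/
theorem HexHullThreshold.cells_twelve_high2 : ∀ l : ℕ, 1921 ≤ l → l ≤ 2160 → l.Prime →
    ∀ d : ℕ, d ∣ 15 → ∃ a₀ : ℕ, (∀ a, a < a₀ → (1 : ℤ) * (7 : ℤ) ^ a * ((7 : ℤ) - 1) < ((l * d : ℕ) : ℤ)) ∧
      ((l * d : ℕ) : ℤ) ≤ 1 * (7 : ℤ) ^ a₀ * ((7 : ℤ) - 1) ∧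
      ¬ HullCell ((l * d : ℕ) : ℤ) ((12 * d : ℕ) : ℤ) ((((l - 1) / 2 - 1 : ℕ) : ℤ) + 1) ((l * d / 6 + 1 : ℕ) : ℤ)
        ((7 : ℤ) ^ a₀ - (a₀ : ℤ) * ((l * d : ℕ) : ℤ)) := by
  intro l hlo hhi hl d hd
  interval_cases l
  all_goals
    first
    | (exfalso; norm_num at hl; done)
    | (rcases HexHullThreshold.eq_of_dvd_fifteen hd with rfl | rfl | rfl | rfl
       all_goals
        first
        | (refine ⟨3, ?_, ?_, ?_⟩ <;>
            [(intro a ha; interval_cases a <;> (norm_num; done)); (norm_num; done); (norm_num [HullCell]; done)])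
        | (refine ⟨4, ?_, ?_, ?_⟩ <;>
            [(intro a ha; interval_cases a <;> (norm_num; done)); (norm_num; done); (norm_num [HullCell]; done)])
        | (refine ⟨5, ?_, ?_, ?_⟩ <;>
            [(intro a ha; interval_cases a <;> (norm_num; done)); (norm_num; done); (norm_num [HullCell]; done)]))

/-- **CELL TABLE, `k = 12`, EVERY prime `2161 ≤ l ≤ 2400` (`B = 15`)**: for every `d ∣ 15` the column `HullCell` FAILS at
`(l·d, 12·d, l⋇, ⌊l·d/6⌋+1, 7^{a₀} − a₀·l·d)`, `a₀` the turning point; `interval_cases l`, composites by `norm_num`, cells by `norm_num`. [folklore] -/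
theorem HexHullThreshold.cells_twelve_high3 : ∀ l : ℕ, 2161 ≤ l → l ≤ 2400 → l.Prime →
    ∀ d : ℕ, d ∣ 15 → ∃ a₀ : ℕ, (∀ a, a < a₀ → (1 : ℤ) * (7 : ℤ) ^ a * ((7 : ℤ) - 1) < ((l * d : ℕ) : ℤ)) ∧
      ((l * d : ℕ) : ℤ) ≤ 1 * (7 : ℤ) ^ a₀ * ((7 : ℤ) - 1) ∧
      ¬ HullCell ((l * d : ℕ) : ℤ) ((12 * d : ℕ) : ℤ) ((((l - 1) / 2 - 1 : ℕ) : ℤ) + 1) ((l * d / 6 + 1 : ℕ) : ℤ)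
        ((7 : ℤ) ^ a₀ - (a₀ : ℤ) * ((l * d : ℕ) : ℤ)) := by
  intro l hlo hhi hl d hd
  interval_cases l
  all_goals
    first
    | (exfalso; norm_num at hl; done)
    | (rcases HexHullThreshold.eq_of_dvd_fifteen hd with rfl | rfl | rfl | rfl
       all_goals
        first
        | (refine ⟨4, ?_, ?_, ?_⟩ <;>
            [(intro a ha; interval_cases a <;> (norm_num; done)); (norm_num; done); (norm_num [HullCell]; done)])
        | (refine ⟨5, ?_, ?_, ?_⟩ <;>
            [(intro a ha; interval_cases a <;> (norm_num; done)); (norm_num; done); (norm_num [HullCell]; done)]))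

/-- **CELL TABLE, `k = 12`, EVERY prime `2401 ≤ l ≤ 2640` (`B = 15`)**: for every `d ∣ 15` the column `HullCell` FAILS at
`(l·d, 12·d, l⋇, ⌊l·d/6⌋+1, 7^{a₀} − a₀·l·d)`, `a₀` the turning point; `interval_cases l`, composites by `norm_num`, cells by `norm_num`. [folklore] -/
theorem HexHullThreshold.cells_twelve_high4 : ∀ l : ℕ, 2401 ≤ l → l ≤ 2640 → l.Prime →
    ∀ d : ℕ, d ∣ 15 → ∃ a₀ : ℕ, (∀ a, a < a₀ → (1 : ℤ) * (7 : ℤ) ^ a * ((7 : ℤ) - 1) < ((l * d : ℕ) : ℤ)) ∧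
      ((l * d : ℕ) : ℤ) ≤ 1 * (7 : ℤ) ^ a₀ * ((7 : ℤ) - 1) ∧
      ¬ HullCell ((l * d : ℕ) : ℤ) ((12 * d : ℕ) : ℤ) ((((l - 1) / 2 - 1 : ℕ) : ℤ) + 1) ((l * d / 6 + 1 : ℕ) : ℤ)
        ((7 : ℤ) ^ a₀ - (a₀ : ℤ) * ((l * d : ℕ) : ℤ)) := by
  intro l hlo hhi hl d hd
  interval_cases l
  all_goals
    first
    | (exfalso; norm_num at hl; done)
    | (rcases HexHullThreshold.eq_of_dvd_fifteen hd with rfl | rfl | rfl | rfl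
       all_goals
        first
        | (refine ⟨4, ?_, ?_, ?_⟩ <;>
            [(intro a ha; interval_cases a <;> (norm_num; done)); (norm_num; done); (norm_num [HullCell]; done)])
        | (refine ⟨5, ?_, ?_, ?_⟩ <;>
            [(intro a ha; interval_cases a <;> (norm_num; done)); (norm_num; done); (norm_num [HullCell]; done)]))

/-- **CELL TABLE, `k = 12`, EVERY prime `2641 ≤ l ≤ 2880` (`B = 15`)**: for every `d ∣ 15` the column `HullCell` FAILS at
`(l·d, 12·d, l⋇, ⌊l·d/6⌋+1, 7^{a₀} − a₀·l·d)`, `a₀` the turning point; `interval_cases l`, composites by `norm_num`, cells by `norm_num`. [folklore] -/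
theorem HexHullThreshold.cells_twelve_high5 : ∀ l : ℕ, 2641 ≤ l → l ≤ 2880 → l.Prime →
    ∀ d : ℕ, d ∣ 15 → ∃ a₀ : ℕ, (∀ a, a < a₀ → (1 : ℤ) * (7 : ℤ) ^ a * ((7 : ℤ) - 1) < ((l * d : ℕ) : ℤ)) ∧
      ((l * d : ℕ) : ℤ) ≤ 1 * (7 : ℤ) ^ a₀ * ((7 : ℤ) - 1) ∧
      ¬ HullCell ((l * d : ℕ) : ℤ) ((12 * d : ℕ) : ℤ) ((((l - 1) / 2 - 1 : ℕ) : ℤ) + 1) ((l * d / 6 + 1 : ℕ) : ℤ)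
        ((7 : ℤ) ^ a₀ - (a₀ : ℤ) * ((l * d : ℕ) : ℤ)) := by
  intro l hlo hhi hl d hd
  interval_cases l
  all_goals
    first
    | (exfalso; norm_num at hl; done)
    | (rcases HexHullThreshold.eq_of_dvd_fifteen hd with rfl | rfl | rfl | rfl
       all_goals
        first
        | (refine ⟨4, ?_, ?_, ?_⟩ <;>
            [(intro a ha; interval_cases a <;> (norm_num; done)); (norm_num; done); (norm_num [HullCell]; done)])
        | (refine ⟨5, ?_, ?_, ?_⟩ <;>
            [(intro a ha; interval_cases a <;> (norm_num; done)); (norm_num; done); (norm_num [HullCell]; done)]))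

/-- **CELL TABLE, `k = 12`, EVERY prime `2881 ≤ l ≤ 3120` (`B = 15`)**: for every `d ∣ 15` the column `HullCell` FAILS at
`(l·d, 12·d, l⋇, ⌊l·d/6⌋+1, 7^{a₀} − a₀·l·d)`, `a₀` the turning point; `interval_cases l`, composites by `norm_num`, cells by `norm_num`. [folklore] -/
theorem HexHullThreshold.cells_twelve_high6 : ∀ l : ℕ, 2881 ≤ l → l ≤ 3120 → l.Prime →
    ∀ d : ℕ, d ∣ 15 → ∃ a₀ : ℕ, (∀ a, a < a₀ → (1 : ℤ) * (7 : ℤ) ^ a * ((7 : ℤ) - 1) < ((l * d : ℕ) : ℤ)) ∧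
      ((l * d : ℕ) : ℤ) ≤ 1 * (7 : ℤ) ^ a₀ * ((7 : ℤ) - 1) ∧
      ¬ HullCell ((l * d : ℕ) : ℤ) ((12 * d : ℕ) : ℤ) ((((l - 1) / 2 - 1 : ℕ) : ℤ) + 1) ((l * d / 6 + 1 : ℕ) : ℤ)
        ((7 : ℤ) ^ a₀ - (a₀ : ℤ) * ((l * d : ℕ) : ℤ)) := by
  intro l hlo hhi hl d hd
  interval_cases l
  all_goals
    first
    | (exfalso; norm_num at hl; done)
    | (rcases HexHullThreshold.eq_of_dvd_fifteen hd with rfl | rfl | rfl | rfl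
       all_goals
        first
        | (refine ⟨4, ?_, ?_, ?_⟩ <;>
            [(intro a ha; interval_cases a <;> (norm_num; done)); (norm_num; done); (norm_num [HullCell]; done)])
        | (refine ⟨5, ?_, ?_, ?_⟩ <;>
            [(intro a ha; interval_cases a <;> (norm_num; done)); (norm_num; done); (norm_num [HullCell]; done)]))

/-- **CELL TABLE, `k = 12`, EVERY prime `3121 ≤ l ≤ 3361` (`B = 15`)**: for every `d ∣ 15` the column `HullCell` FAILS at
`(l·d, 12·d, l⋇, ⌊l·d/6⌋+1, 7^{a₀} − a₀·l·d)`, `a₀` the turning point; `interval_cases l`, composites by `norm_num`, cells by `norm_num`. [folklore] -/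
theorem HexHullThreshold.cells_twelve_high7 : ∀ l : ℕ, 3121 ≤ l → l ≤ 3361 → l.Prime →
    ∀ d : ℕ, d ∣ 15 → ∃ a₀ : ℕ, (∀ a, a < a₀ → (1 : ℤ) * (7 : ℤ) ^ a * ((7 : ℤ) - 1) < ((l * d : ℕ) : ℤ)) ∧
      ((l * d : ℕ) : ℤ) ≤ 1 * (7 : ℤ) ^ a₀ * ((7 : ℤ) - 1) ∧
      ¬ HullCell ((l * d : ℕ) : ℤ) ((12 * d : ℕ) : ℤ) ((((l - 1) / 2 - 1 : ℕ) : ℤ) + 1) ((l * d / 6 + 1 : ℕ) : ℤ)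
        ((7 : ℤ) ^ a₀ - (a₀ : ℤ) * ((l * d : ℕ) : ℤ)) := by
  intro l hlo hhi hl d hd
  interval_cases l
  all_goals
    first
    | (exfalso; norm_num at hl; done)
    | (rcases HexHullThreshold.eq_of_dvd_fifteen hd with rfl | rfl | rfl | rfl
       all_goals
        first
        | (refine ⟨4, ?_, ?_, ?_⟩ <;>
            [(intro a ha; interval_cases a <;> (norm_num; done)); (norm_num; done); (norm_num [HullCell]; done)])
        | (refine ⟨5, ?_, ?_, ?_⟩ <;>
            [(intro a ha; interval_cases a <;> (norm_num; done)); (norm_num; done); (norm_num [HullCell]; done)]))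

/-! ## §2. The band -/

/-- **GENUINE-NEG, `k = 12`, EVERY prime `1681 ≤ l ≤ 3361`** (`11–480`: abc-iut-W-neg-2; `481–1680`: part B): at EVERY genuine Θ-volume
datum `T` over `(ratPoint λ_12, l)`, for EVERY choice of the free context binders and Kummer data, `Cor312Vol.PilotKummerCompatHull` at the sharp
genuine setting with the CHOSEN realising ideles and the PINNED reading FAILS — the engine p473071 at `B = 15`, top label, cells of §1.
[cite: Mochizuki2012, IUTchIII Cor. 3.12 Step (xi-f) p. 184; IUTchIV Prop. 1.2 (i)(ii) p. 10] [claim: Mochizuki2012, status: disputed] -/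
theorem HexHullThreshold.not_pilotKummerCompatHull_lamSeven_twelve_band_high {l : ℕ} (hl : l.Prime) (hlo : 1681 ≤ l) (hhi : l ≤ 3361)
    (T : Cor22.ThetaVolumeDatumAt (ratPoint ((2 : ℚ)⁻¹ + 2 / 7 ^ 12)) l) :
    letI := T.instFieldF; letI := T.instNumberFieldF; letI := T.instAlgebraF; letI := T.instFieldK
    letI := T.instNumberFieldK; letI := T.instAlgebraK; letI := T.instFieldFbar; letI := T.instAlgebraFbar
    letI := T.instAlgebraKFbar; letI := T.instIsElliptic
    ∀ (M : Type) [Field M] [NumberField M]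
      (archPk : ∀ (j : (thetaIndex (pilotDataOfK T.D T.K)).Label) (vQ : (thetaIndex (pilotDataOfK T.D T.K)).VQ),
        Set ((logShellsDH (pilotDataOfK T.D T.K) (analyticLogv T.K)).Packet j vQ))
      (archSub : ∀ (j : (thetaIndex (pilotDataOfK T.D T.K)).Label) (v : (thetaIndex (pilotDataOfK T.D T.K)).V),
        Set ((logShellsDH (pilotDataOfK T.D T.K) (analyticLogv T.K)).Packet j ((thetaIndex (pilotDataOfK T.D T.K)).over v)))
      (Ψ : ℤ → ∀ v : (thetaIndex (pilotDataOfK T.D T.K)).V, v ∈ (thetaIndex (pilotDataOfK T.D T.K)).Vbad →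
        Set ((logShellsDH (pilotDataOfK T.D T.K) (analyticLogv T.K)).StarPacket v))
      (act : ℤ → ∀ v : (thetaIndex (pilotDataOfK T.D T.K)).V, v ∈ (thetaIndex (pilotDataOfK T.D T.K)).Vbad →
        (logShellsDH (pilotDataOfK T.D T.K) (analyticLogv T.K)).StarPacket v →
          Module.End ℚ ((logShellsDH (pilotDataOfK T.D T.K) (analyticLogv T.K)).StarPacket v))
      (Mmod : ℤ → ∀ j : (thetaIndex (pilotDataOfK T.D T.K)).LabelStar,
        Set ((logShellsDH (pilotDataOfK T.D T.K) (analyticLogv T.K)).GlobalPacket j.1))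
      (region : ℤ → ∀ j : (thetaIndex (pilotDataOfK T.D T.K)).LabelStar, FinDivisor M →
        ∀ vQ : (thetaIndex (pilotDataOfK T.D T.K)).VQ, Set ((logShellsDH (pilotDataOfK T.D T.K) (analyticLogv T.K)).Packet j.1 vQ))
      (frobAdm : ℤ → ℤ → ∀ (j : (thetaIndex (pilotDataOfK T.D T.K)).Label) (vQ : (thetaIndex (pilotDataOfK T.D T.K)).VQ),
        Set ((logShellsDH (pilotDataOfK T.D T.K) (analyticLogv T.K)).Packet j vQ) → Prop)
      (frobLogvol : ℤ → ℤ → ∀ (j : (thetaIndex (pilotDataOfK T.D T.K)).Label) (vQ : (thetaIndex (pilotDataOfK T.D T.K)).VQ),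
        Set ((logShellsDH (pilotDataOfK T.D T.K) (analyticLogv T.K)).Packet j vQ) → ℝ)
      (frobΨ : ℤ → ℤ → ∀ v : (thetaIndex (pilotDataOfK T.D T.K)).V, v ∈ (thetaIndex (pilotDataOfK T.D T.K)).Vbad →
        Set ((logShellsDH (pilotDataOfK T.D T.K) (analyticLogv T.K)).StarPacket v))
      (frobMmod : ℤ → ℤ → ∀ j : (thetaIndex (pilotDataOfK T.D T.K)).LabelStar,
        Set ((logShellsDH (pilotDataOfK T.D T.K) (analyticLogv T.K)).GlobalPacket j.1))
      (unitImage : ℤ → ℤ → ℕ → ∀ (j : (thetaIndex (pilotDataOfK T.D T.K)).Label) (vQ : (thetaIndex (pilotDataOfK T.D T.K)).VQ),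
        Set ((logShellsDH (pilotDataOfK T.D T.K) (analyticLogv T.K)).Packet j vQ))
      (ballImage : ℤ → ℤ → ∀ (j : (thetaIndex (pilotDataOfK T.D T.K)).Label) (vQ : (thetaIndex (pilotDataOfK T.D T.K)).VQ),
        Set ((logShellsDH (pilotDataOfK T.D T.K) (analyticLogv T.K)).Packet j vQ))
      (thetaDiv : ℤ → ℤ → LgpDivisor M (thetaIndex (pilotDataOfK T.D T.K)).lstar)
      (n : ℤ) {HT : Type} {LogLink : HT → HT → Type} {IsFull : ∀ {s t : HT}, LogLink s t → Prop}
      (lat : LGPGaussianLogThetaLattice LogLink IsFull)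
      {Frd : Type} {IsoF : Frd → Frd → Type} {Ob : Frd → Type} {realify : Frd → Frd} {Strip : Type}
      {IsoS : Strip → Strip → Type} {Mv : ∀ v : (thetaIndex (pilotDataOfK T.D T.K)).V, v ∈ (thetaIndex (pilotDataOfK T.D T.K)).Vbad → Type}
      [∀ v h, Monoid (Mv v h)]
      (sig : GlobalLGPFrobenioidSignature (thetaIndex (pilotDataOfK T.D T.K)).lstar (thetaIndex (pilotDataOfK T.D T.K)).V
        (· ∈ (thetaIndex (pilotDataOfK T.D T.K)).Vbad) Frd IsoF Ob realify Strip IsoS Mv)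
      (split : SplittingMonoids Mv) {ObΔ : Type}
      {N : ∀ v : (thetaIndex (pilotDataOfK T.D T.K)).V, v ∈ (thetaIndex (pilotDataOfK T.D T.K)).Vbad → Type}
      [∀ v h, Monoid (N v h)] (qData : QPilotData ObΔ N)
      (qK : ∀ v : (thetaIndex (pilotDataOfK T.D T.K)).V, v ∈ (thetaIndex (pilotDataOfK T.D T.K)).Vbad →
        Set ((logShellsDH (pilotDataOfK T.D T.K) (analyticLogv T.K)).StarPacket v)),
    ¬ Cor312Vol.PilotKummerCompatHull
        (LatticeSituation.ofShells (logShellsDH (pilotDataOfK T.D T.K) (analyticLogv T.K)) M archPk archSub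
          (summandPiecesPr (pilotDataOfK T.D T.K) (logvAnalytic_analyticLogv (F := T.K))).Adm
          (summandPiecesPr (pilotDataOfK T.D T.K) (logvAnalytic_analyticLogv (F := T.K))).logvol Ψ act Mmod region frobAdm
          frobLogvol frobΨ frobMmod unitImage ballImage thetaDiv)
        (settingPrVolSharp (pilotDataOfK T.D T.K) (logvAnalytic_analyticLogv (F := T.K)) M archPk archSub Ψ act Mmod region n
          lat sig split qData (exists_realising_qIdeles_pilotDataOfK T.D).choose (exists_realising_thetaIdeles_pilotDataOfK T.D).choose
          (exists_realising_qIdeles_pilotDataOfK T.D).choose_spec.1 (exists_realising_qIdeles_pilotDataOfK T.D).choose_spec.2.1)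
        (fun _ => Cor312.Setting.qRegion
          (settingPrVolSharp (pilotDataOfK T.D T.K) (logvAnalytic_analyticLogv (F := T.K)) M archPk archSub Ψ act Mmod region n
            lat sig split qData (exists_realising_qIdeles_pilotDataOfK T.D).choose (exists_realising_thetaIdeles_pilotDataOfK T.D).choose
            (exists_realising_qIdeles_pilotDataOfK T.D).choose_spec.1 (exists_realising_qIdeles_pilotDataOfK T.D).choose_spec.2.1))
        qK := by
  have hlk : ¬ l ∣ 12 := fun h => by have := Nat.le_of_dvd (by norm_num) h; omega
  have hcell : ∀ d : ℕ, d ∣ 15 → ∃ a₀ : ℕ, (∀ a, a < a₀ → (1 : ℤ) * (7 : ℤ) ^ a * ((7 : ℤ) - 1) < ((l * d : ℕ) : ℤ)) ∧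
    ((l * d : ℕ) : ℤ) ≤ 1 * (7 : ℤ) ^ a₀ * ((7 : ℤ) - 1) ∧
    ¬ HullCell ((l * d : ℕ) : ℤ) ((12 * d : ℕ) : ℤ) ((((l - 1) / 2 - 1 : ℕ) : ℤ) + 1) ((l * d / 6 + 1 : ℕ) : ℤ)
    ((7 : ℤ) ^ a₀ - (a₀ : ℤ) * ((l * d : ℕ) : ℤ)) := by
    rcases le_or_gt l 1920 with h0 | h0
    · exact HexHullThreshold.cells_twelve_high1 l (by omega) h0 hl
    rcases le_or_gt l 2160 with h1 | h1
    · exact HexHullThreshold.cells_twelve_high2 l (by omega) h1 hl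
    rcases le_or_gt l 2400 with h2 | h2
    · exact HexHullThreshold.cells_twelve_high3 l (by omega) h2 hl
    rcases le_or_gt l 2640 with h3 | h3
    · exact HexHullThreshold.cells_twelve_high4 l (by omega) h3 hl
    rcases le_or_gt l 2880 with h4 | h4
    · exact HexHullThreshold.cells_twelve_high5 l (by omega) h4 hl
    rcases le_or_gt l 3120 with h5 | h5
    · exact HexHullThreshold.cells_twelve_high6 l (by omega) h5 hl
    exact HexHullThreshold.cells_twelve_high7 l (by omega) hhi hl
  exact GenuineK.not_pilotKummerCompatHull_lamSeven_of_not_hullCell (B := 15) (i := (l - 1) / 2 - 1) (by norm_num) hl (by omega) hlk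
    (by omega) T (fun x₀ => (GenuineK.localType_lamSeven_fifteen (by norm_num) ⟨6, rfl⟩ (by omega) T x₀).2) hcell

end Summit.ABC.IUTFork.Conditional

end
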